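import Literature.NumberTheory.Rogawski1990.ArchUnitaryPlaneEigenframeCompact   -- ★ `isCompact_setOf_norm_apply_le_and_inv` (the compact box of `GL_N(ℂ)`)
import Literature.NumberTheory.Automorphic.UnitaryGroupAutomorphicRep         -- ★ `unitaryGroupOfForm`, `mem_unitaryGroupOfForm_iff`
import Mathlib.MeasureTheory.Measure.Regular
import HarnessLib

/-!
# The split torus of `U(Φ₃)(ℂ) ≅ U(2,1)` at a regular HYPERBOLIC diagonal `γ = diag(α, u, ᾱ⁻¹)`: the `χ`-shell `{t ∈ Z(γ) ∣ |t₀₀|² ∈ [1, l]}` is COMPACT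
# (input `hκ` of ★ `QuotientMeasureSlabDescent` for the (H′-ball) orbit-volume bound at the hyperbolic classes of `U(2,1)`; Beuzart-Plessis 2020 §1.2∕§1.8)

Topic `NumberTheory/Rogawski1990`; namespace `Literature.NumberTheory.Rogawski1990`.  THEOREMS ONLY (no `def`, no instance, no notation, no axiom, no named fact,
no `sorry`).  Cell `pub/hodgecm-mathlib`, crux H413 (`stmt-HodgeConjecture-24833`), F0∕P3c line LH2 kit, piece (c) «hκ» of (H′-ball) (LH2-p03 (g3) «YES (c)»
2026-09-02T04:37:41Z; LH2-plan «GO (SLAB-DESCENT)∕(H′-ball)» 04:28:48Z); seat LH2-p04 (g2).  The `U(2,1)` twin of ★ `ArchSplitTorusShell.isCompact_chi_Icc`.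

THE MATHEMATICS.  Let `Γ ≤ GL₃(ℂ)` be any CLOSED subgroup of `Φ₃`-unitary matrices (`Γ = U(Φ₃)(ℂ)` = ★ `unitaryGroupOfForm (starRingEnd ℂ) Φ₃`, or a place carrier), and
`γ ∈ Γ` with matrix `diag(α, u, ᾱ⁻¹)`, `|u| = 1`, `α ≠ 0`, `|α| ≠ 1` (regular hyperbolic).  The three diagonal entries are pairwise distinct, so every `t` in the
centraliser `Z_Γ(γ)` is DIAGONAL (private `apply_eq_zero_of_ne`), and `Φ₃`-unitarity of a diagonal `t` reads `t̄₀₀ t₂₂ = 1`, `|t₁₁| = 1` (private).  Hence on the shell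
`|t₀₀|² ∈ [1, l]` all entries of `t` and of `t⁻¹ = diag(t₀₀⁻¹, t₁₁⁻¹, t₂₂⁻¹)` are bounded by `√(max l 1)`, i.e. the shell lies in the compact box of ★
`isCompact_setOf_norm_apply_le_and_inv`; being closed (centraliser closed, `χ` continuous, `Γ ↪ GL₃(ℂ)` a closed embedding) it is COMPACT
(`isCompact_setOf_centralizer_normSq_mem_Icc`), so of finite mass for every measure finite on compacts (`measure_setOf_centralizer_normSq_mem_Icc_lt_top` ∕ `_ne_top`) —
the hypothesis `hκ : ρ {t ∣ ‖t₀₀‖² ∈ Icc 1 l} ≠ ⊤` of ★ `quotientMeasure_setOf_descConj_le_le_inv_mul_measure` at this torus.  The character `χ(t) = |t₀₀|²` itself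
(multiplicative, continuous, onto `ℝ_{>0}`) and `IsClosed Z(γ)` are LH2-p01 (g3)'s (Z″) and are not restated here.
HONEST LABEL: HC_CM is proved only modulo the 7 printed citations (2 remaining: hLiu418 = stmt-HodgeConjecture-24832, h413 = stmt-HodgeConjecture-24833) until rung 0
closes; count-neutral kit under the LETTERS O1″∕O3″ (`stub_N8`).

## References
* [BeuzartPlessis2020Asterisque] R. Beuzart-Plessis, Astérisque 418 (2020), §1.8 p. 39; §1.2 (1.2.2), (1.2.4) p. 21 (orbit estimates at split tori).
* [Rogawski1990] J. D. Rogawski, Ann. of Math. Stud. 123 (1990), §3.6 p. 28 (Cartan subgroups of `U(3)`), §1.9 p. 8 (`U_Φ`).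
* [PlatonovRapinchuk1994] V. Platonov, A. Rapinchuk, *Algebraic Groups and Number Theory* (1994), §3.2 Thm 3.1 (compactness criteria).
-/

set_option autoImplicit false

noncomputable section

open MeasureTheory Set Literature.NumberTheory.Automorphic Literature.NumberTheory.Automorphic.UnitaryGroup
open scoped Matrix ComplexConjugate ENNReal

namespace Literature.NumberTheory.Rogawski1990

section HyperbolicTorusThree

variable {Γ : Subgroup (GL (Fin 3) ℂ)}
  (hΓ : Γ ≤ unitaryGroupOfForm (starRingEnd ℂ) (Matrix.of fun i j : Fin 3 => if i.val + j.val + 1 = 3 then (1 : ℂ) else 0))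
  {γ : ↥Γ} {α u : ℂ} (hγ : (((γ : ↥Γ) : GL (Fin 3) ℂ) : Matrix (Fin 3) (Fin 3) ℂ) = !![α, 0, 0; 0, u, 0; 0, 0, (star α)⁻¹]) (hu : ‖u‖ = 1) (hα : α ≠ 0) (hα1 : ‖α‖ ≠ 1)

include hu hα hα1 in
/-- The three diagonal entries `α`, `u`, `ᾱ⁻¹` of a regular hyperbolic representative are pairwise distinct. [cite: Rogawski1990, §3.6 p. 28] -/
private theorem diag_entries_ne : α ≠ u ∧ α ≠ (star α)⁻¹ ∧ u ≠ (star α)⁻¹ := by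
  have hsα : star α ≠ 0 := star_ne_zero.2 hα
  have hnβ : ‖(star α)⁻¹‖ = ‖α‖⁻¹ := by rw [norm_inv, norm_star]
  refine ⟨fun h => hα1 (by rw [h, hu]), fun h => hα1 ?_, fun h => ?_⟩
  · -- `‖α‖ = ‖α‖⁻¹` ⇒ `‖α‖ = 1`
    have hpos : 0 < ‖α‖ := norm_pos_iff.2 hα
    have h1 : ‖α‖ = ‖α‖⁻¹ := (congrArg norm h).trans hnβ
    have h2 : ‖α‖ * ‖α‖ = 1 := by
      have h3 := congrArg (fun x => x * ‖α‖) h1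
      simpa [inv_mul_cancel₀ hpos.ne'] using h3
    nlinarith [norm_nonneg α]
  · apply hα1
    have h1 : ‖α‖⁻¹ = 1 := by rw [← hnβ, ← h, hu]
    exact inv_eq_one.1 h1

include hγ hu hα hα1 in
/-- Every element of the centraliser of the regular hyperbolic `γ` is DIAGONAL: `t_ij = 0` for `i ≠ j` (compare `(tγ)_ij = t_ij γ_jj` with `(γt)_ij = γ_ii t_ij`).
[cite: Rogawski1990, §3.6 p. 28] -/
private theorem apply_eq_zero_of_ne {t : ↥Γ} (ht : t ∈ Subgroup.centralizer ({γ} : Set ↥Γ)) (i j : Fin 3) (hij : i ≠ j) : (((t : ↥Γ) : GL (Fin 3) ℂ) : Matrix (Fin 3) (Fin 3) ℂ) i j = 0 := by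
  obtain ⟨hαu, hαβ, huβ⟩ := diag_entries_ne hu hα hα1
  have h := Subgroup.mem_centralizer_singleton_iff.1 ht
  have hm : (((t : ↥Γ) : GL (Fin 3) ℂ) : Matrix (Fin 3) (Fin 3) ℂ) * (((γ : ↥Γ) : GL (Fin 3) ℂ) : Matrix (Fin 3) (Fin 3) ℂ) = (((γ : ↥Γ) : GL (Fin 3) ℂ) : Matrix (Fin 3) (Fin 3) ℂ) * (((t : ↥Γ) : GL (Fin 3) ℂ) : Matrix (Fin 3) (Fin 3) ℂ) := by
    have := congrArg (fun z : ↥Γ => ((z : GL (Fin 3) ℂ) : Matrix (Fin 3) (Fin 3) ℂ)) h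
    simpa only [Subgroup.coe_mul, Units.val_mul] using this
  rw [hγ] at hm
  have hm' := fun a b => congrFun (congrFun hm a) b
  fin_cases i <;> fin_cases j
  all_goals first
    | exact absurd rfl hij
    | skip
  · have e := hm' 0 1
    simp [Matrix.mul_apply, Fin.sum_univ_three] at e
    -- e : t01 * u = α * t01
    have hz : (u - α) * (((t : ↥Γ) : GL (Fin 3) ℂ) : Matrix (Fin 3) (Fin 3) ℂ) 0 1 = 0 := by linear_combination e
    rcases mul_eq_zero.1 hz with h' | h'
    · exact absurd (sub_eq_zero.1 h') (Ne.symm hαu)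
    · exact h'
  · have e := hm' 0 2
    simp [Matrix.mul_apply, Fin.sum_univ_three] at e
    have hz : ((star α)⁻¹ - α) * (((t : ↥Γ) : GL (Fin 3) ℂ) : Matrix (Fin 3) (Fin 3) ℂ) 0 2 = 0 := by linear_combination e
    rcases mul_eq_zero.1 hz with h' | h'
    · exact absurd (sub_eq_zero.1 h') (Ne.symm hαβ)
    · exact h'
  · have e := hm' 1 0
    simp [Matrix.mul_apply, Fin.sum_univ_three] at e
    have hz : (α - u) * (((t : ↥Γ) : GL (Fin 3) ℂ) : Matrix (Fin 3) (Fin 3) ℂ) 1 0 = 0 := by linear_combination e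
    rcases mul_eq_zero.1 hz with h' | h'
    · exact absurd (sub_eq_zero.1 h') hαu
    · exact h'
  · have e := hm' 1 2
    simp [Matrix.mul_apply, Fin.sum_univ_three] at e
    have hz : ((star α)⁻¹ - u) * (((t : ↥Γ) : GL (Fin 3) ℂ) : Matrix (Fin 3) (Fin 3) ℂ) 1 2 = 0 := by linear_combination e
    rcases mul_eq_zero.1 hz with h' | h'
    · exact absurd (sub_eq_zero.1 h') (Ne.symm huβ)
    · exact h'
  · have e := hm' 2 0
    simp [Matrix.mul_apply, Fin.sum_univ_three] at e
    have hz : (α - (star α)⁻¹) * (((t : ↥Γ) : GL (Fin 3) ℂ) : Matrix (Fin 3) (Fin 3) ℂ) 2 0 = 0 := by linear_combination e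
    rcases mul_eq_zero.1 hz with h' | h'
    · exact absurd (sub_eq_zero.1 h') hαβ
    · exact h'
  · have e := hm' 2 1
    simp [Matrix.mul_apply, Fin.sum_univ_three] at e
    have hz : (u - (star α)⁻¹) * (((t : ↥Γ) : GL (Fin 3) ℂ) : Matrix (Fin 3) (Fin 3) ℂ) 2 1 = 0 := by linear_combination e
    rcases mul_eq_zero.1 hz with h' | h'
    · exact absurd (sub_eq_zero.1 h') huβ
    · exact h'

include hΓ hγ hu hα hα1 in
/-- `Φ₃`-unitarity of a (diagonal) element of the centraliser: `t̄₀₀ t₂₂ = 1` and `|t₁₁| = 1`. [cite: Rogawski1990, §1.9 p. 8] -/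
private theorem diag_unitarity {t : ↥Γ} (ht : t ∈ Subgroup.centralizer ({γ} : Set ↥Γ)) :
    star ((((t : ↥Γ) : GL (Fin 3) ℂ) : Matrix (Fin 3) (Fin 3) ℂ) 0 0) * (((t : ↥Γ) : GL (Fin 3) ℂ) : Matrix (Fin 3) (Fin 3) ℂ) 2 2 = 1 ∧ ‖(((t : ↥Γ) : GL (Fin 3) ℂ) : Matrix (Fin 3) (Fin 3) ℂ) 1 1‖ = 1 := by
  have h0 := apply_eq_zero_of_ne hγ hu hα hα1 ht
  have hunit := mem_unitaryGroupOfForm_iff.1 (hΓ t.2)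
  have e02 := congrFun (congrFun hunit 0) 2
  have e11 := congrFun (congrFun hunit 1) 1
  simp [Matrix.mul_apply, Fin.sum_univ_three, h0 0 1 (by decide), h0 1 0 (by decide), h0 2 0 (by decide), h0 2 1 (by decide)] at e02 e11
  refine ⟨by simpa using e02, ?_⟩
  -- e11 : star t11 * t11 = 1
  have h2 : ‖(((t : ↥Γ) : GL (Fin 3) ℂ) : Matrix (Fin 3) (Fin 3) ℂ) 1 1‖ * ‖(((t : ↥Γ) : GL (Fin 3) ℂ) : Matrix (Fin 3) (Fin 3) ℂ) 1 1‖ = 1 := by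
    have := congrArg norm e11
    simpa [norm_mul, norm_star] using this
  nlinarith [norm_nonneg ((((t : ↥Γ) : GL (Fin 3) ℂ) : Matrix (Fin 3) (Fin 3) ℂ) 1 1)]

include hΓ hγ hu hα hα1 in
/-- **THE `χ`-SHELL OF THE SPLIT TORUS IS COMPACT**: for every `l`, `{t ∈ Z_Γ(γ) ∣ |t₀₀|² ∈ [1, l]}` is a compact subset of the centraliser of the regular hyperbolic
`γ = diag(α, u, ᾱ⁻¹)` in any closed `Γ ≤ U(Φ₃)(ℂ)` — it is closed and its elements `t = diag(t₀₀, t₁₁, t̄₀₀⁻¹)` and their inverses have all entries bounded by `√(max l 1)`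
(★ `isCompact_setOf_norm_apply_le_and_inv`). [cite: BeuzartPlessis2020Asterisque, §1.8 p. 39; §1.2 (1.2.2), (1.2.4) p. 21] [cite: PlatonovRapinchuk1994, §3.2 Thm 3.1] -/
theorem isCompact_setOf_centralizer_normSq_mem_Icc (hΓc : IsClosed (Γ : Set (GL (Fin 3) ℂ))) (l : ℝ) :
    IsCompact {t : ↥(Subgroup.centralizer ({γ} : Set ↥Γ)) | ‖(((((t : ↥(Subgroup.centralizer ({γ} : Set ↥Γ))) : ↥Γ) : ↥Γ) : GL (Fin 3) ℂ) : Matrix (Fin 3) (Fin 3) ℂ) 0 0‖ ^ 2 ∈ Icc 1 l} := by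
  set B : ℝ := Real.sqrt (max l 1) with hB
  have hB1 : 1 ≤ B := by
    rw [hB]; exact Real.one_le_sqrt.2 (le_max_right _ _)
  -- closed embedding `Γ ↪ GL₃(ℂ)` and the compact box
  have hemb : Topology.IsClosedEmbedding (Subtype.val : ↥Γ → GL (Fin 3) ℂ) := hΓc.isClosedEmbedding_subtypeVal
  have hK := hemb.isCompact_preimage (isCompact_setOf_norm_apply_le_and_inv 3 B)
  -- continuity of the `(0,0)` entry on `Γ`
  have hv : Continuous fun y : ↥Γ => (((y : ↥Γ) : GL (Fin 3) ℂ) : Matrix (Fin 3) (Fin 3) ℂ) := Units.continuous_val.comp continuous_subtype_val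
  have hχ : Continuous fun y : ↥Γ => ‖(((y : ↥Γ) : GL (Fin 3) ℂ) : Matrix (Fin 3) (Fin 3) ℂ) 0 0‖ ^ 2 := (((continuous_apply 0).comp ((continuous_apply 0).comp hv)).norm).pow 2
  -- the image of the shell in `Γ` is closed
  have hZc : IsClosed ((Subgroup.centralizer ({γ} : Set ↥Γ)) : Set ↥Γ) := by
    have e : ((Subgroup.centralizer ({γ} : Set ↥Γ)) : Set ↥Γ) = {y | y * γ = γ * y} := by
      ext y; exact Subgroup.mem_centralizer_singleton_iff
    rw [e]
    exact isClosed_eq (continuous_id.mul continuous_const) (continuous_const.mul continuous_id)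
  have hclosed : IsClosed ({y : ↥Γ | y ∈ Subgroup.centralizer ({γ} : Set ↥Γ)} ∩ {y | ‖(((y : ↥Γ) : GL (Fin 3) ℂ) : Matrix (Fin 3) (Fin 3) ℂ) 0 0‖ ^ 2 ∈ Icc 1 l}) :=
    hZc.inter (isClosed_Icc.preimage hχ)
  rw [Subtype.isCompact_iff]
  have himg : ((↑) : ↥(Subgroup.centralizer ({γ} : Set ↥Γ)) → ↥Γ) '' {t : ↥(Subgroup.centralizer ({γ} : Set ↥Γ)) | ‖(((((t : ↥(Subgroup.centralizer ({γ} : Set ↥Γ))) : ↥Γ) : ↥Γ) : GL (Fin 3) ℂ) : Matrix (Fin 3) (Fin 3) ℂ) 0 0‖ ^ 2 ∈ Icc 1 l} =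
      {y : ↥Γ | y ∈ Subgroup.centralizer ({γ} : Set ↥Γ)} ∩ {y | ‖(((y : ↥Γ) : GL (Fin 3) ℂ) : Matrix (Fin 3) (Fin 3) ℂ) 0 0‖ ^ 2 ∈ Icc 1 l} := by
    ext y
    constructor
    · rintro ⟨t, ht, rfl⟩; exact ⟨t.2, ht⟩
    · rintro ⟨hy, hχy⟩; exact ⟨⟨y, hy⟩, hχy, rfl⟩
  rw [himg]
  refine hK.of_isClosed_subset hclosed ?_
  rintro y ⟨hy, hχ1, hχ2⟩
  -- structure of `y`
  have h0 := apply_eq_zero_of_ne hγ hu hα hα1 hy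
  obtain ⟨h02, h11⟩ := diag_unitarity hΓ hγ hu hα hα1 hy
  set a : ℂ := (((y : ↥Γ) : GL (Fin 3) ℂ) : Matrix (Fin 3) (Fin 3) ℂ) 0 0 with ha
  set b : ℂ := (((y : ↥Γ) : GL (Fin 3) ℂ) : Matrix (Fin 3) (Fin 3) ℂ) 1 1 with hb
  set c : ℂ := (((y : ↥Γ) : GL (Fin 3) ℂ) : Matrix (Fin 3) (Fin 3) ℂ) 2 2 with hc
  -- norms
  have ha1 : 1 ≤ ‖a‖ := by nlinarith [hχ1, norm_nonneg a]
  have ha0 : a ≠ 0 := fun h => by rw [h, norm_zero] at ha1; linarith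
  have haB : ‖a‖ ≤ B := by
    have h := Real.abs_le_sqrt (hχ2.trans (le_max_left l 1))
    rwa [abs_of_nonneg (norm_nonneg _), ← hB] at h
  have hb0 : b ≠ 0 := fun h => by rw [h, norm_zero] at h11; exact zero_ne_one h11
  have hbB : ‖b‖ ≤ B := by rw [h11]; exact hB1
  have hsa0 : star a ≠ 0 := star_ne_zero.2 ha0
  have hc : c = (star a)⁻¹ := by
    have := h02
    field_simp
    simpa [mul_comm] using this
  have hc0 : c ≠ 0 := by rw [hc]; exact inv_ne_zero hsa0
  have hcn : ‖c‖ = ‖a‖⁻¹ := by rw [hc, norm_inv, norm_star]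
  have hcB : ‖c‖ ≤ B := by
    rw [hcn]
    exact (inv_le_one_of_one_le₀ ha1).trans hB1
  have haiB : ‖a‖⁻¹ ≤ B := (inv_le_one_of_one_le₀ ha1).trans hB1
  have hbiB : ‖b‖⁻¹ ≤ B := by rw [h11, inv_one]; exact hB1
  have hciB : ‖c‖⁻¹ ≤ B := by rw [hcn, inv_inv]; exact haB
  have hB0 : 0 ≤ B := le_trans zero_le_one hB1
  -- the matrix of `y` and of `y⁻¹`
  have hM : (((y : ↥Γ) : GL (Fin 3) ℂ) : Matrix (Fin 3) (Fin 3) ℂ) = !![a, 0, 0; 0, b, 0; 0, 0, c] := by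
    ext i j
    fin_cases i <;> fin_cases j
    · rfl
    · exact h0 0 1 (by decide)
    · exact h0 0 2 (by decide)
    · exact h0 1 0 (by decide)
    · rfl
    · exact h0 1 2 (by decide)
    · exact h0 2 0 (by decide)
    · exact h0 2 1 (by decide)
    · rfl
  have hinv : ((((y : ↥Γ) : GL (Fin 3) ℂ) : Matrix (Fin 3) (Fin 3) ℂ))⁻¹ = !![a⁻¹, 0, 0; 0, b⁻¹, 0; 0, 0, c⁻¹] := by
    rw [hM]
    apply Matrix.inv_eq_left_inv
    ext i j
    fin_cases i <;> fin_cases j <;> simp [Matrix.mul_apply, Fin.sum_univ_three, ha0, hb0, hc0]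
  intro i j
  rw [Matrix.coe_units_inv, hinv, hM]
  fin_cases i <;> fin_cases j <;> simp [haB, hbB, hcB, haiB, hbiB, hciB, hB0]

include hΓ hγ hu hα hα1 in
/-- **FINITENESS OF THE `χ`-SHELL MASS** — the hypothesis `hκ` of ★ `quotientMeasure_setOf_descConj_le_le_inv_mul_measure` at the split torus of `U(2,1)`: for every measure `ρ`
on the centraliser finite on compacts and every `l`, `ρ {t ∣ |t₀₀|² ∈ [1, l]} < ⊤`. [cite: BeuzartPlessis2020Asterisque, §1.8 p. 39; §1.2 (1.2.2), (1.2.4) p. 21] -/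
theorem measure_setOf_centralizer_normSq_mem_Icc_lt_top (hΓc : IsClosed (Γ : Set (GL (Fin 3) ℂ)))
    [MeasurableSpace ↥(Subgroup.centralizer ({γ} : Set ↥Γ))] (ρ : Measure ↥(Subgroup.centralizer ({γ} : Set ↥Γ))) [IsFiniteMeasureOnCompacts ρ] (l : ℝ) :
    ρ {t : ↥(Subgroup.centralizer ({γ} : Set ↥Γ)) | ‖(((((t : ↥(Subgroup.centralizer ({γ} : Set ↥Γ))) : ↥Γ) : ↥Γ) : GL (Fin 3) ℂ) : Matrix (Fin 3) (Fin 3) ℂ) 0 0‖ ^ 2 ∈ Icc 1 l} < ⊤ :=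
  (isCompact_setOf_centralizer_normSq_mem_Icc hΓ hγ hu hα hα1 hΓc l).measure_lt_top

include hΓ hγ hu hα hα1 in
/-- The same as `≠ ⊤` (the literal shape of the `hκ` binder). [cite: BeuzartPlessis2020Asterisque, §1.8 p. 39; §1.2 (1.2.2), (1.2.4) p. 21] -/
theorem measure_setOf_centralizer_normSq_mem_Icc_ne_top (hΓc : IsClosed (Γ : Set (GL (Fin 3) ℂ)))
    [MeasurableSpace ↥(Subgroup.centralizer ({γ} : Set ↥Γ))] (ρ : Measure ↥(Subgroup.centralizer ({γ} : Set ↥Γ))) [IsFiniteMeasureOnCompacts ρ] (l : ℝ) :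
    ρ {t : ↥(Subgroup.centralizer ({γ} : Set ↥Γ)) | ‖(((((t : ↥(Subgroup.centralizer ({γ} : Set ↥Γ))) : ↥Γ) : ↥Γ) : GL (Fin 3) ℂ) : Matrix (Fin 3) (Fin 3) ℂ) 0 0‖ ^ 2 ∈ Icc 1 l} ≠ ⊤ :=
  (measure_setOf_centralizer_normSq_mem_Icc_lt_top hΓ hγ hu hα hα1 hΓc ρ l).ne

end HyperbolicTorusThree

end Literature.NumberTheory.Rogawski1990

end
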